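import Summits.ABC.StewartYu.PrimePadicSocketRad
import HarnessLib

/-!
# Cell abc-stewartyu: the prime-argument `p`-adic SOCKET of the abc assembly, IV —
# socket A⁺: an abc-type bound from a crude `p`-adic bound at prime arguments

`Summits/ABC/StewartYu/PrimePadicSocket.lean` — sequel to
`PrimePadicSocketRad.lean` (theorems only: no definition, no named fact).

**Socket A⁺** (`bakerShapeBound_of_primePadicBound_general`). If for every prime `p`, all distinct
primes `q₁, …, qₙ ≠ p` and all `e ∈ ℤⁿ ∖ {0}` with `∏ qᵢ^{eᵢ} ≠ 1`,

  `ord_p(q₁^{e₁}⋯qₙ^{eₙ} − 1) ≤ K · Lⁿ · n^{κn} · p^σ · (log q₁ ⋯ log qₙ) ·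
      (log max(3, max|eᵢ|) + log p + ∑ᵢ log qᵢ)^{τ₀ + τ₁ n}`

(`K ≥ 0`, `L ≥ 1`, `κ, σ ≥ 0` real, `τ₀, τ₁ ∈ ℕ`), then every abc triple satisfies
`log c ≤ C · rad(abc)^{κ+σ+3τ₁+1}` (`BakerShapeBound (κ+σ+3τ₁+1) 0`); hence `BakerShapeBound θ 0`
for every `θ ≥ κ+σ+3τ₁+1` (`…_of_le`), and the named fact `stewartTijdeman1986_upperBound`
(`log c ≤ κ R^{15}` [cite: StewartTijdeman1986, Theorem 1 (upper bound), as quoted in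
Waldschmidt2014 §2 (PDF p. 3)]) whenever `κ + σ + 3τ₁ + 1 ≤ 15`
(`stewartTijdeman1986_of_primePadicBound_general`). Compared with Theorem A of
`BakerMethodBoundsStewartTijdemanGenericProofs.lean` (`κ, σ ≤ 14`, fixed power `τ` of
`log max(3, max|eᵢ|)`), the socket accepts: any `κ, σ ≥ 0`; a power of the logarithm growing
linearly in `n` (Baker's method WITHOUT Kummer descent, Gel'fond–Baker quality); and `log p`,
`∑ log qᵢ` inside the logarithm (the `Ω log Ω (log B + log Ω)` and `log(B p^{n+1} ∏ h')` shapes).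
It does NOT accept constants `e^{Ω(n²)}` in the number `n` of logarithms, nor a theorem about
principal units priced by their own heights (`h(q^{p−1}) = (p−1) log q`, a factor `pⁿ`): those are
not absorbable against any power of the radical. No archimedean estimate is used.

Nothing here is claimed to be in print beyond the summation pattern of Stewart–Tijdeman 1986
[cite: ShoreyTijdeman1986, Ch. 1, proof of Theorem 1.2 (PDF p. 48)]; the exponent
`κ + σ + 3τ₁ + 1` is this file's book-keeping, not a published constant.

## References

* [StewartTijdeman1986] C. L. Stewart, R. Tijdeman, *On the Oesterlé–Masser conjecture*, Monatsh.
  Math. 102 (1986), 251–257 — Theorem 1, as quoted in [Waldschmidt2014] §2.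
* [Waldschmidt2014] M. Waldschmidt, *Lecture on the abc conjecture and some of its consequences*,
  Springer Proc. Math. Stat. 98 (2015), §2 (PDF p. 3).
* [ShoreyTijdeman1986] T. N. Shorey, R. Tijdeman, *Exponential Diophantine Equations*, Cambridge
  Tracts in Math. 87, CUP 1986 — Ch. 1, Theorem 1.2 and its proof.
-/


noncomputable section

open Finset Real
open Literature.NumberTheory.DiophantineGeometry

namespace Summit.ABC.StewartYu

open Literature.Barriers.ABC Literature.Barriers.ABC.StewartTijdemanGeneric


/-! ### The general socket: an abc-type bound from a crude prime-argument `p`-adic bound -/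

/-- **Socket A⁺ (general prime-argument `p`-adic socket of the abc assembly).** Suppose that for
every prime `p`, all distinct primes `q₁, …, qₙ ≠ p` and all `e ∈ ℤⁿ ∖ {0}` with `∏ qᵢ^{eᵢ} ≠ 1`,
`ord_p(q₁^{e₁}⋯qₙ^{eₙ} − 1) ≤ K · Lⁿ · n^{κn} · p^σ · (log q₁ ⋯ log qₙ) ·
  (log max(3, max|eᵢ|) + log p + ∑ᵢ log qᵢ)^{τ₀ + τ₁ n}`
with constants `K ≥ 0`, `L ≥ 1`, `κ, σ ≥ 0` (real) and `τ₀, τ₁ ∈ ℕ` — i.e. a `p`-adic lower bound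
for linear forms in the logarithms of rational primes of ANY classical quality: `n^{O(n)} p^{O(1)}`
constants, a power of the logarithm of the coefficients growing linearly with the number of
logarithms (Baker's method WITHOUT Kummer descent), and the sizes of `p` and of the `qᵢ` allowed
inside that logarithm. Then every abc triple satisfies `log c ≤ C · rad(abc)^{κ+σ+3τ₁+1}`
(`BakerShapeBound (κ + σ + 3τ₁ + 1) 0`). Proof: `sum_padicPart_le_rad_general` at `x = c`,
`{y, z} = {a, b}`, `p₀ = 0` (`log c = ∑_{p ∣ c} ord_p(c) log p`), then the endgame
`bakerShapeBound_of_loglog_rpow` with `δ = 1/(8θ)`. No archimedean estimate is used. [folklore] -/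
theorem bakerShapeBound_of_primePadicBound_general {K L κ σ : ℝ} {τ₀ τ₁ : ℕ} (hK : 0 ≤ K)
    (hL : 1 ≤ L) (hκ0 : 0 ≤ κ) (hσ0 : 0 ≤ σ)
    (hP : ∀ (p n : ℕ) (q : Fin n → ℕ) (e : Fin n → ℤ), p.Prime →
      (∀ i, (q i).Prime) → Function.Injective q → (∀ i, q i ≠ p) → e ≠ 0 →
      ∏ i, ((q i : ℚ)) ^ e i ≠ 1 →
      (padicValRat p (∏ i, ((q i : ℚ)) ^ e i - 1) : ℝ) ≤
        K * L ^ n * (n : ℝ) ^ (κ * n) * (p : ℝ) ^ σ * (∏ i, Real.log (q i)) *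
          (Real.log (max 3 ((Finset.univ.sup fun i => (e i).natAbs : ℕ) : ℝ)) + Real.log p +
            ∑ i, Real.log (q i)) ^ (τ₀ + τ₁ * n)) :
    BakerShapeBound (κ + σ + 3 * τ₁ + 1) 0 := by
  classical
  set θ : ℝ := κ + σ + 3 * τ₁ + 1 with hθ
  set μ : ℝ := κ + σ + 3 * τ₁ + 5 / 8 with hμ
  have hθ1 : 1 ≤ θ := by
    rw [hθ]; have : (0 : ℝ) ≤ 3 * (τ₁ : ℝ) := by positivity
    linarith
  have hθ0 : 0 < θ := by linarith
  have hμ0 : 0 ≤ μ := by rw [hμ]; positivity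
  set δ : ℝ := 1 / (8 * θ) with hδ
  have hδ0 : 0 < δ := by rw [hδ]; positivity
  have hδθ : δ * θ = 1 / 8 := by rw [hδ]; field_simp
  have hδ1 : δ ≤ 1 := by
    rw [hδ, div_le_one (by positivity)]; linarith
  have h2δ : 2 * δ < 1 := by
    have : δ ≤ 1 / 8 := by rw [hδ]; exact one_div_le_one_div_of_le (by norm_num) (by linarith)
    linarith
  have hμθ : μ ≤ θ * (1 - 2 * δ) := by
    have : θ * (1 - 2 * δ) = θ - 2 * (δ * θ) := by ring
    rw [this, hδθ, hμ, hθ]; linarith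
  -- the constant `A` absorbing `C^{ω}`
  set C₀ : ℝ := 4 * L * Real.exp κ * (((τ₁ : ℝ) + 1) / δ) ^ τ₁ with hC₀
  have hC₀1 : 1 ≤ C₀ := by
    have h1 : 1 ≤ 4 * L * Real.exp κ := by
      have := Real.one_le_exp (le_of_lt (lt_of_le_of_lt hκ0 (lt_add_one κ)))
      nlinarith [Real.one_le_exp hκ0]
    have h2 : (1 : ℝ) ≤ ((τ₁ : ℝ) + 1) / δ := by
      rw [le_div_iff₀ hδ0]; nlinarith
    rw [hC₀]
    exact one_le_mul_of_one_le_of_one_le h1 (one_le_pow₀ h2)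
  obtain ⟨A, hA1, hA⟩ := exists_pow_card_le_prod_rpow hC₀1 (by norm_num : (0 : ℝ) < 1 / 8)
  have hA0 : 0 ≤ A := zero_le_one.trans hA1
  set M₀ : ℝ := 48 * K * A * Real.exp τ₁ * (16 * ((τ₀ : ℝ) + 1)) ^ τ₀ with hM₀
  have hM₀0 : 0 ≤ M₀ := by rw [hM₀]; positivity
  refine bakerShapeBound_of_loglog_rpow (μ := μ) (τ := τ₀) (M := 3 * M₀ + 1) hμ0 hδ0 h2δ hμθ
    (by positivity) fun a b c ht => ?_
  obtain ⟨ha, hb, habc, hcop⟩ := ht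
  have hc0 : c ≠ 0 := by omega
  have hR1 : (1 : ℝ) ≤ (rad a b c : ℝ) := one_le_rad_real a b c
  have hRμ : (1 : ℝ) ≤ (rad a b c : ℝ) ^ μ := Real.one_le_rpow hR1 hμ0
  set Y : ℝ := max 3 (Real.log c) with hYdef
  have hY3 : (3 : ℝ) ≤ Y := le_max_left _ _
  have hY1 : (1 : ℝ) ≤ Y := le_trans (by norm_num) hY3
  have hl3 : 1 ≤ Real.log 3 := by
    rw [Real.le_log_iff_exp_le (by norm_num)]
    exact Real.exp_one_lt_d9.le.trans (by norm_num)
  have hlogY1 : 1 ≤ Real.log Y := hl3.trans (Real.log_le_log (by norm_num) hY3)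
  have hYδ : 1 ≤ Y ^ δ := Real.one_le_rpow hY1 hδ0.le
  have hlogYτ : 1 ≤ Real.log Y ^ τ₀ := one_le_pow₀ hlogY1
  rcases eq_or_ne a b with rfl | hab
  · -- `a = b = 1`, `c = 2`
    have ha1 : a = 1 := Nat.Coprime.eq_one_of_dvd hcop (dvd_refl a)
    have hc2 : c = 2 := by omega
    subst hc2
    have h2 : Real.log ((2 : ℕ) : ℝ) ≤ 1 := by
      push_cast; linarith only [Real.log_two_lt_d9]
    calc Real.log ((2 : ℕ) : ℝ) ≤ 1 := h2
      _ ≤ (3 * M₀ + 1) * (rad a a 2 : ℝ) ^ μ * Y ^ δ * Real.log Y ^ τ₀ := by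
          have h1 : (1 : ℝ) ≤ 3 * M₀ + 1 := by linarith
          calc (1 : ℝ) = 1 * 1 * 1 * 1 := by ring
            _ ≤ (3 * M₀ + 1) * (rad a a 2 : ℝ) ^ μ * Y ^ δ * Real.log Y ^ τ₀ :=
                mul_le_mul (mul_le_mul (mul_le_mul h1 hRμ zero_le_one (by positivity)) hYδ
                  zero_le_one (by positivity)) hlogYτ zero_le_one (by positivity)
  · -- the generic case: expand `c`
    have hcopc : Nat.Coprime c (a * b) := by
      have hac : Nat.Coprime a c := by rw [← habc]; exact Nat.coprime_self_add_right.mpr hcop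
      have hbc : Nat.Coprime b c := by rw [← habc]; exact Nat.coprime_add_self_right.mpr hcop.symm
      exact (Nat.Coprime.mul_left hac hbc).symm
    have hdvd : (c : ℤ) ∣ (a : ℤ) ^ 2 - (b : ℤ) ^ 2 :=
      ⟨(a : ℤ) - b, by rw [← habc]; push_cast; ring⟩
    have hP' : ∀ (p n : ℕ) (q : Fin n → ℕ) (e : Fin n → ℤ), p.Prime → 0 ≤ p →
        (∀ i, (q i).Prime) → Function.Injective q → (∀ i, q i ≠ p) → e ≠ 0 →
        ∏ i, ((q i : ℚ)) ^ e i ≠ 1 →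
        (padicValRat p (∏ i, ((q i : ℚ)) ^ e i - 1) : ℝ) ≤
          K * L ^ n * (n : ℝ) ^ (κ * n) * (p : ℝ) ^ σ * (∏ i, Real.log (q i)) *
            (Real.log (max 3 ((Finset.univ.sup fun i => (e i).natAbs : ℕ) : ℝ)) + Real.log p +
              ∑ i, Real.log (q i)) ^ (τ₀ + τ₁ * n) :=
      fun p n q e hp _ => hP p n q e hp
    have hmem := sum_padicPart_le_rad_general (p₀ := 0) hK hL hκ0 hσ0 hδ0 hP' hA0 hA
      (by omega) ha hb hab hcop hcopc hdvd
    -- the left-hand side is `log c`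
    have hfilter : c.primeFactors.filter (fun p => 0 ≤ p) = c.primeFactors :=
      Finset.filter_true_of_mem fun p _ => Nat.zero_le p
    have hlogc : Real.log c = ∑ p ∈ c.primeFactors, (c.factorization p : ℝ) * Real.log p := by
      have h1 := Nat.prod_primeFactors_pow_factorization hc0
      have h2 : (c : ℝ) = ∏ p ∈ c.primeFactors, (p : ℝ) ^ c.factorization p := by
        exact_mod_cast h1
      rw [h2, Real.log_prod]
      · exact Finset.sum_congr rfl fun p _ => Real.log_pow _ _
      · intro p hp
        exact pow_ne_zero _ (by exact_mod_cast (Nat.prime_of_mem_primeFactors hp).ne_zero)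
    rw [hfilter, ← hlogc] at hmem
    -- the radical and the logarithms
    have hrad : (((∏ q ∈ (c * (a * b)).primeFactors, q : ℕ)) : ℝ) = (rad a b c : ℝ) := by
      rw [rad_def, Nat.radical_eq_prod_primeFactors, show c * (a * b) = a * b * c by ring]
    rw [hrad] at hmem
    have hmaxpos : (0 : ℝ) < (max a b : ℕ) := by exact_mod_cast lt_max_of_lt_left ha
    have hmaxc : Real.log (max a b : ℕ) ≤ Real.log c :=
      Real.log_le_log hmaxpos (by exact_mod_cast (max_le (by omega) (by omega) : max a b ≤ c))
    have hW : Real.log (max 3 (Real.log (max a b : ℕ))) ^ τ₀ ≤ Real.log Y ^ τ₀ := by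
      apply pow_le_pow_left₀ (Real.log_nonneg (le_trans (by norm_num) (le_max_left _ _)))
      exact Real.log_le_log (lt_of_lt_of_le (by norm_num) (le_max_left _ _))
        (max_le_max le_rfl hmaxc)
    have hY₃ : (max 3 (3 * Real.log (max a b : ℕ)) : ℝ) ^ δ ≤ 3 * Y ^ δ := by
      have hle : (max 3 (3 * Real.log (max a b : ℕ)) : ℝ) ≤ 3 * Y :=
        max_le (by linarith) (by linarith [le_max_right 3 (Real.log c)])
      have h0 : (0 : ℝ) ≤ max 3 (3 * Real.log (max a b : ℕ)) := le_trans (by norm_num) (le_max_left _ _)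
      calc (max 3 (3 * Real.log (max a b : ℕ)) : ℝ) ^ δ ≤ (3 * Y) ^ δ :=
            Real.rpow_le_rpow h0 hle hδ0.le
        _ = (3 : ℝ) ^ δ * Y ^ δ := Real.mul_rpow (by norm_num) (by linarith)
        _ ≤ 3 * Y ^ δ := by
            apply mul_le_mul_of_nonneg_right _ (by linarith)
            calc (3 : ℝ) ^ δ ≤ (3 : ℝ) ^ (1 : ℝ) :=
                  Real.rpow_le_rpow_of_exponent_le (by norm_num) hδ1
              _ = 3 := Real.rpow_one 3
    have hRμ0 : (0 : ℝ) ≤ (rad a b c : ℝ) ^ μ := by positivity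
    calc Real.log c ≤ M₀ * (rad a b c : ℝ) ^ μ * (max 3 (3 * Real.log (max a b : ℕ))) ^ δ *
          Real.log (max 3 (Real.log (max a b : ℕ))) ^ τ₀ := by rw [hM₀, hμ]; exact hmem
      _ ≤ M₀ * (rad a b c : ℝ) ^ μ * (3 * Y ^ δ) * Real.log Y ^ τ₀ := by
          apply mul_le_mul _ hW (pow_nonneg (Real.log_nonneg (le_trans (by norm_num)
            (le_max_left _ _))) τ₀) (by positivity)
          exact mul_le_mul_of_nonneg_left hY₃ (by positivity)
      _ = 3 * M₀ * (rad a b c : ℝ) ^ μ * Y ^ δ * Real.log Y ^ τ₀ := by ring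
      _ ≤ (3 * M₀ + 1) * (rad a b c : ℝ) ^ μ * Y ^ δ * Real.log Y ^ τ₀ := by
          apply mul_le_mul_of_nonneg_right _ (by positivity)
          apply mul_le_mul_of_nonneg_right _ (by positivity)
          apply mul_le_mul_of_nonneg_right _ hRμ0
          linarith

/-- **Socket A⁺, any larger exponent.** Under the hypothesis of
`bakerShapeBound_of_primePadicBound_general`, `BakerShapeBound θ 0` for every
`θ ≥ κ + σ + 3τ₁ + 1`. [folklore] -/
theorem bakerShapeBound_of_primePadicBound_general_of_le {K L κ σ θ : ℝ} {τ₀ τ₁ : ℕ} (hK : 0 ≤ K)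
    (hL : 1 ≤ L) (hκ0 : 0 ≤ κ) (hσ0 : 0 ≤ σ) (hθ : κ + σ + 3 * τ₁ + 1 ≤ θ)
    (hP : ∀ (p n : ℕ) (q : Fin n → ℕ) (e : Fin n → ℤ), p.Prime →
      (∀ i, (q i).Prime) → Function.Injective q → (∀ i, q i ≠ p) → e ≠ 0 →
      ∏ i, ((q i : ℚ)) ^ e i ≠ 1 →
      (padicValRat p (∏ i, ((q i : ℚ)) ^ e i - 1) : ℝ) ≤
        K * L ^ n * (n : ℝ) ^ (κ * n) * (p : ℝ) ^ σ * (∏ i, Real.log (q i)) *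
          (Real.log (max 3 ((Finset.univ.sup fun i => (e i).natAbs : ℕ) : ℝ)) + Real.log p +
            ∑ i, Real.log (q i)) ^ (τ₀ + τ₁ * n)) :
    BakerShapeBound θ 0 :=
  bakerShapeBound_zero_mono hθ (bakerShapeBound_of_primePadicBound_general hK hL hκ0 hσ0 hP)

/-- **Stewart–Tijdeman 1986 (`log c ≤ κ R^{15}`, the named fact `stewartTijdeman1986_upperBound`)
from socket A⁺** whenever `κ + σ + 3τ₁ + 1 ≤ 15` — e.g. van der Poorten's quality `(κ, σ, τ₁) =
(12, 1, 0)`, or a descent-free bound with `(κ, σ, τ₁) = (κ, σ, 1)`, `κ + σ ≤ 11`.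
[cite: StewartTijdeman1986, Theorem 1 (upper bound), as quoted in Waldschmidt2014 §2 (PDF p. 3)] -/
theorem stewartTijdeman1986_of_primePadicBound_general {K L κ σ : ℝ} {τ₀ τ₁ : ℕ} (hK : 0 ≤ K)
    (hL : 1 ≤ L) (hκ0 : 0 ≤ κ) (hσ0 : 0 ≤ σ) (h15 : κ + σ + 3 * τ₁ + 1 ≤ 15)
    (hP : ∀ (p n : ℕ) (q : Fin n → ℕ) (e : Fin n → ℤ), p.Prime →
      (∀ i, (q i).Prime) → Function.Injective q → (∀ i, q i ≠ p) → e ≠ 0 →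
      ∏ i, ((q i : ℚ)) ^ e i ≠ 1 →
      (padicValRat p (∏ i, ((q i : ℚ)) ^ e i - 1) : ℝ) ≤
        K * L ^ n * (n : ℝ) ^ (κ * n) * (p : ℝ) ^ σ * (∏ i, Real.log (q i)) *
          (Real.log (max 3 ((Finset.univ.sup fun i => (e i).natAbs : ℕ) : ℝ)) + Real.log p +
            ∑ i, Real.log (q i)) ^ (τ₀ + τ₁ * n)) :
    stewartTijdeman1986_upperBound :=
  bakerShapeBound_of_primePadicBound_general_of_le hK hL hκ0 hσ0 h15 hP

end Summit.ABC.StewartYu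

end
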